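import Mathlib.Algebra.Group.Pointwise.Finset.Basic
import Literature.Combinatorics.Additive.TripleProductProperty
import HarnessLib

/-!
# Orem's one-quotient test for the triple product property (Hedtke–Murthy 2012, Lemma 5.3)

Topic `Literature/Combinatorics/Additive` (companion of `TripleProductProperty.lean`,
`NeumannTPPInequality.lean`, `TripleProductPropertySAT.lean`).

I. Hedtke, S. Murthy, *Search and test algorithms for triple product property triples*, Groups
Complex. Cryptol. 4 (2012), doi:10.1515/gcc-2012-0006 = arXiv:1104.5097, §5, Lemma 5.3, verbatim:

> From Hendrik Orem we know the following equivalent form of the TPP: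
> **Lemma 5.3.** Subsets `S`, `T` and `U` of `G` satisfy the TPP iff
> `|S⁻¹| · |U| = |S⁻¹U|` and `(S⁻¹ (Q(T) ∖ 1) U) ∩ S⁻¹U = ∅`.
> Note that for a TPP test based on the lemma above we only need to compute one of the right
> quotients, instead of all three right quotients in the original TPP definition.

Here `Q(T) = T T⁻¹ = {t t'⁻¹}` is the right quotient set (the paper's Def. 1.1, "`Q(X) := {x y⁻¹ :
x, y ∈ X}`" for `∅ ≠ X ⊆ G`) of the tree's `TripleProductProperty` (Cohn–Umans 2003, Def. 2.1 = the
paper's Def. 1.2: `s s'⁻¹ · t t'⁻¹ · u u'⁻¹ = 1 ⇒ s = s', t = t', u = u'`), and the lemma is the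
rearrangement `s s'⁻¹ (t t'⁻¹) u u'⁻¹ = 1 ⟺ s'⁻¹ (t t'⁻¹) u = s⁻¹ u'`: a violating sextuple with
`t ≠ t'` is exactly a common element of `S⁻¹ (Q(T) ∖ 1) U` and `S⁻¹ U`, and one with `t = t'` is
exactly a coincidence `s'⁻¹ u = s⁻¹ u'` with `(s', u) ≠ (s, u')`, i.e. a failure of
`|S⁻¹ U| = |S⁻¹| |U|`.  The paper defines the TPP only for NON-EMPTY subsets (Def. 1.2: "the nonempty
subsets `S`, `T` and `U` of a group `G` fulfill the Triple Product Property (TPP) if …"), whereas the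
tree's predicate is also (vacuously) true when a set is empty; for the forward implication exactly
`T ≠ ∅` is needed (with `T = ∅` the TPP is vacuous while `|S⁻¹ U| = |S⁻¹| |U|` can fail), so that
hypothesis is explicit below, and the converse is stated without it.  This is the correctness
statement behind the paper's Algorithm 5.4 (a TPP test computing one right quotient instead of
three).  Held text: `paper:arxiv-1104.5097` chunk p0009 L27–36 (Lemma 5.3 and the remark),
chunk p0003 L33–39 (Defs. 1.1–1.2).

## What is here (all proved; 0 definitions, 0 named facts)

* `tpp_rel_iff` — the rearrangement `s s'⁻¹ q (u u'⁻¹) = 1 ↔ s'⁻¹ q u = s⁻¹ u'`;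
* `TripleProductProperty.card_inv_mul` — TPP with `T ≠ ∅` ⇒ `|S⁻¹| · |U| = |S⁻¹ U|`;
* `TripleProductProperty.disjoint_inv_mul_quot_mul` — TPP ⇒ `S⁻¹ (Q(T) ∖ 1) U ∩ S⁻¹ U = ∅`;
* `tripleProductProperty_of_card_of_disjoint` — the converse (no non-emptiness needed);
* `HedtkeMurthy2012_lemma53` — **Lemma 5.3** as printed (an `↔`, for `T ≠ ∅`).

## References
* I. Hedtke, S. Murthy, arXiv:1104.5097 = Groups Complex. Cryptol. 4 (2012): Lemma 5.3 (attributed to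
  H. Orem), held-text chunk p0009; Algorithm 5.4. [HedtkeMurthy2012]
* H. Cohn, C. Umans, FOCS 2003, arXiv:math/0307321, Def. 2.1 (the TPP). [CohnUmans2003]
-/

open Finset
open scoped Pointwise

namespace Literature.Combinatorics.Additive

variable {G : Type*} [Group G]

/-- The rearrangement behind Orem's test: `s s'⁻¹ · q · (u u'⁻¹) = 1 ↔ s'⁻¹ q u = s⁻¹ u'`.
[folklore] (the computation implicit in [cite: HedtkeMurthy2012, Lemma 5.3]) -/
theorem tpp_rel_iff (s s' q u u' : G) :
    s * s'⁻¹ * q * (u * u'⁻¹) = 1 ↔ s'⁻¹ * q * u = s⁻¹ * u' := by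
  rw [show s * s'⁻¹ * q * (u * u'⁻¹) = s * (s'⁻¹ * q * u) * u'⁻¹ by simp only [mul_assoc],
    mul_inv_eq_one, ← eq_inv_mul_iff_mul_eq]

variable [DecidableEq G]

/-- **Hedtke–Murthy 2012, Lemma 5.3, first condition (⇒)**: if `(S, T, U)` has the triple product
property and `T ≠ ∅`, then `(s, u) ↦ s⁻¹ u` is injective on `S × U`, i.e. `|S⁻¹| · |U| = |S⁻¹ U|`.
[cite: HedtkeMurthy2012, Lemma 5.3] -/
theorem TripleProductProperty.card_inv_mul {S T U : Finset G} (h : TripleProductProperty S T U)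
    (hT : T.Nonempty) : S⁻¹.card * U.card = (S⁻¹ * U).card := by
  obtain ⟨t, ht⟩ := hT
  refine (Finset.card_mul_iff.2 ?_).symm
  rintro ⟨a, u⟩ hx ⟨a', u'⟩ hy (he : a * u = a' * u')
  simp only [Set.mem_prod, Finset.mem_coe, Finset.mem_inv'] at hx hy
  -- `a = s'⁻¹`, `a' = s⁻¹` with `s' := a⁻¹ ∈ S`, `s := a'⁻¹ ∈ S`
  have hrel : a'⁻¹ * a⁻¹⁻¹ * (t * t⁻¹) * (u * u'⁻¹) = 1 := by
    rw [tpp_rel_iff, inv_inv, inv_inv, mul_inv_cancel, mul_one, he]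
  obtain ⟨h1, -, h3⟩ := h _ hy.1 _ hx.1 t ht t ht u hx.2 u' hy.2 hrel
  rw [inv_inj] at h1
  rw [h1, h3]

/-- **Hedtke–Murthy 2012, Lemma 5.3, second condition (⇒)**: if `(S, T, U)` has the triple product
property then `S⁻¹ (Q(T) ∖ 1) U` and `S⁻¹ U` are disjoint (`Q(T) = T T⁻¹`).
[cite: HedtkeMurthy2012, Lemma 5.3] -/
theorem TripleProductProperty.disjoint_inv_mul_quot_mul {S T U : Finset G}
    (h : TripleProductProperty S T U) :
    Disjoint (S⁻¹ * ((T * T⁻¹).erase 1) * U) (S⁻¹ * U) := by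
  rw [Finset.disjoint_left]
  intro x hx hx'
  rw [Finset.mem_mul] at hx hx'
  obtain ⟨y, hy, u, hu, rfl⟩ := hx
  rw [Finset.mem_mul] at hy
  obtain ⟨a, ha, q, hq, rfl⟩ := hy
  obtain ⟨a', ha', u', hu', he⟩ := hx'
  rw [Finset.mem_inv'] at ha ha'
  rw [Finset.mem_erase, Finset.mem_mul] at hq
  obtain ⟨hq1, t, ht, w, hw, rfl⟩ := hq
  rw [Finset.mem_inv'] at hw
  -- the relation `a q u = a' u'` is a TPP relation with middle quotient `q = t w = t (w⁻¹)⁻¹ ≠ 1`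
  have hrel : a'⁻¹ * a⁻¹⁻¹ * (t * w⁻¹⁻¹) * (u * u'⁻¹) = 1 := by
    rw [tpp_rel_iff, inv_inv, inv_inv, inv_inv, he]
  obtain ⟨-, h2, -⟩ := h _ ha' _ ha t ht _ hw u hu u' hu' hrel
  exact hq1 (by rw [h2, inv_mul_cancel])

omit [DecidableEq G] in
/-- **Hedtke–Murthy 2012, Lemma 5.3 (⇐)**: if `|S⁻¹| · |U| = |S⁻¹ U|` and
`S⁻¹ (Q(T) ∖ 1) U ∩ S⁻¹ U = ∅`, then `(S, T, U)` has the triple product property (no non-emptiness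
needed). [cite: HedtkeMurthy2012, Lemma 5.3] -/
theorem tripleProductProperty_of_card_of_disjoint [DecidableEq G] {S T U : Finset G}
    (hcard : S⁻¹.card * U.card = (S⁻¹ * U).card)
    (hdisj : Disjoint (S⁻¹ * ((T * T⁻¹).erase 1) * U) (S⁻¹ * U)) :
    TripleProductProperty S T U := by
  intro s hs s' hs' t ht t' ht' u hu u' hu' hrel
  rw [tpp_rel_iff] at hrel
  by_cases hq : t * t'⁻¹ = 1
  · -- `t = t'`, and `s'⁻¹ u = s⁻¹ u'` is a coincidence of the injective map `(a, u) ↦ a u`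
    have htt : t = t' := mul_inv_eq_one.1 hq
    rw [hq, mul_one] at hrel
    have hinj := Finset.card_mul_iff.1 hcard.symm
    have hmem : ∀ {a v : G}, a⁻¹ ∈ S → v ∈ U → (a, v) ∈ ((S⁻¹ : Finset G) : Set G) ×ˢ (U : Set G) :=
      fun ha hv => ⟨by simpa only [Finset.mem_coe, Finset.mem_inv'] using ha, hv⟩
    have key := hinj (hmem (a := s'⁻¹) (by rw [inv_inv]; exact hs') hu)
      (hmem (a := s⁻¹) (by rw [inv_inv]; exact hs) hu') hrel
    simp only [Prod.mk.injEq, inv_inj] at key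
    exact ⟨key.1.symm, htt, key.2⟩
  · -- `t t'⁻¹ ∈ Q(T) ∖ 1`: the element `s'⁻¹ (t t'⁻¹) u = s⁻¹ u'` lies in both sets
    exfalso
    have hx1 : s'⁻¹ * (t * t'⁻¹) * u ∈ S⁻¹ * ((T * T⁻¹).erase 1) * U :=
      Finset.mul_mem_mul (Finset.mul_mem_mul (Finset.inv_mem_inv hs')
        (Finset.mem_erase.2 ⟨hq, Finset.mul_mem_mul ht (Finset.inv_mem_inv ht')⟩)) hu
    have hx2 : s'⁻¹ * (t * t'⁻¹) * u ∈ S⁻¹ * U := by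
      rw [hrel]
      exact Finset.mul_mem_mul (Finset.inv_mem_inv hs) hu'
    exact Finset.disjoint_left.1 hdisj hx1 hx2

/-- **Hedtke–Murthy 2012, Lemma 5.3 (H. Orem's equivalent form of the TPP)**: for finite subsets
`S, T, U` of a group with `T ≠ ∅`, `(S, T, U)` has the triple product property iff
`|S⁻¹| · |U| = |S⁻¹ U|` and `(S⁻¹ (Q(T) ∖ 1) U) ∩ S⁻¹ U = ∅`, where `Q(T) = T T⁻¹`
("for a TPP test based on the lemma above we only need to compute one of the right quotients").
[cite: HedtkeMurthy2012, Lemma 5.3] -/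
theorem HedtkeMurthy2012_lemma53 {S T U : Finset G} (hT : T.Nonempty) :
    TripleProductProperty S T U ↔
      S⁻¹.card * U.card = (S⁻¹ * U).card ∧ Disjoint (S⁻¹ * ((T * T⁻¹).erase 1) * U) (S⁻¹ * U) :=
  ⟨fun h => ⟨h.card_inv_mul hT, h.disjoint_inv_mul_quot_mul⟩,
    fun h => tripleProductProperty_of_card_of_disjoint h.1 h.2⟩

end Literature.Combinatorics.Additive
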